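import Summits.NavierStokesRegularity.NavierStokesRegularity.Theses.PumpContinuation
import Summits.NavierStokesRegularity.NavierStokesRegularity.Theorems.PerpetualPumpEulerTypeIGlueDuhamel
import Summits.NavierStokesRegularity.NavierStokesRegularity.Theorems.BoundedTemperatureClosed.Negative.IsSymmetricDecoration
import Summits.NavierStokesRegularity.NavierStokesRegularity.Theorems.EulerTypeIGlue.Negative.WithoutLerayHopfFalse
import Literature.Analysis.FluidPDE.TaoAveragedSobolevProofs
import Literature.Analysis.FluidPDE.TaoAveragedCascade
import Literature.Analysis.FluidPDE.TaoCascadeProjection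
import Literature.Analysis.FluidPDE.TaoAveragedComplexAverageReal
import Literature.Analysis.FluidPDE.TaoAveragedCascadeAssembly
import Literature.Analysis.FluidPDE.TaoCascadeWaveletData

/-!
# Disproof of `EulerProximatePump` (stmt-NavierStokesRegularity-18302) — findings

INDEX (newest first).

## Cycle 1 of the crux DISPROVER (refuter-cdisprove-stmt-NavierStokesRegularity-18302-0, 2026-08-17)

Verdict so far: **no kill; the crux resists because `¬Door ⊢ Type-I exclusion for Navier–Stokes from
Schwartz data at every ceiling`** (`noNSTypeI_of_not_door` below, now LANDED as
`Theorems/EulerProximatePump/Negative/DoorObstructions.lean`, p145292) — an open problem (KNSS 2009 only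
axisymmetric). A formalisation-junk audit found no loophole: `IsMildSolutionFor` demands `H¹⁰`-continuity
on the whole time set (no junk extensions past a blow-up time), `pairing` is junk-free, the Bochner junk
of `eulerForm`/`form`/the time integral is never reachable from continuous `H¹⁰_df`-valued curves, the
heat junk (`τ < 0`) is unused, `eLpNorm ⊤` of an `L²` class is honest. New kernel-checked content of this
cycle (section "Cycle 1 (cdisprove)" at the end of the file):

* (a) LOAD-BEARING ANALYSIS. `door_iff_noSymm` — `IsSymmetric` is decoration (symmetrise; Tao Rem. 1.6);
  `door_iff_noNonneg` — `0 ≤ θ` is decoration; `doorWithoutNonExtension_trivial` — with the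
  non-extension clause dropped the crux is inhabited by the ZERO FLOW (datum `0`, `u ≡ 0`, `M = 0`):
  the blow-up clause is the only load-bearing conjunct; `typeIBlowupFor_mono` — ceilings enlarge.
  (An `∃`-crux has no hypotheses to drop; these are the conjunct-level mutations.)
* (b) TIGHTNESS. Cold sector `M ≤ 0` empty (`typeIBlowupFor_pos`, rattack) — `∃ M` means `∃ M > 0`.
* (c) SMALL MODELS / REFUTED STRENGTHENINGS. The heat equation is on admissible segments and never
  blows up: `continuousInH10On_heat` (strong continuity of `e^{tΔ}` in `H¹⁰`),
  `eq_heat_of_isMildSolutionFor_zeroForm` (uniqueness for the zero form), `not_typeIBlowupFor_zeroForm`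
  (`∀ M, ¬ TypeIBlowupFor 0 M`); the ZERO DATUM (`AveragingDatum.zero`, `mᵢ ≡ 0`) is symmetric and
  cancelling with segment `T_θ = θ·B` (`segForm_zeroDatum`): heat equation at `θ = 0`, positive
  multiples of `B` for `θ > 0` — a SECOND collapse of the Door onto NSTypeI (after `euler`), and
  `not_forall_admissible_seedIgnited : ¬ ∀ 𝒜 sym canc, ∃ M, TypeIBlowupFor (segForm 𝒜 0) M` — the
  route's seed `0 ∈ S_M` / "clopen from 0" skeleton is datum-specific, not class-wide. Also
  `not_typeIBlowupFor_segForm_minusEuler_half` — the segment through `−B` is cold at `θ = 1/2`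
  (blow-up sets along admissible segments have interior holes). LANDED as
  `Theorems/EulerProximatePump/Negative/HeatOnSegment.lean` (p145657).
* (d) TARGETS (lead's line `Lines/SketchIdeator2.lean`, 5 stubs + tools; payload targets = ∅): NONE
  BREAKABLE from the negative side — `stub_blowupTypeIDssProfile` = stmt-0155 = ¬(Type-I DSS Liouville,
  Bradshaw–Tsai OP 5.1): refuting it is proving Tsai's conjecture (only Chae–Wolf near `λ = 1` in tree,
  `chaeWolf2017_removing_dss_holds`: any witness needs a coarse ratio); `stub_dssTruncationBridgeTypeI` =
  stmt-14478: an implication whose hypothesis is NS-hard, so not refutable by a counterexample — but its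
  CONTENT (far-field truncation of an infinite-energy DSS profile to rapidly decaying data KEEPING the
  Type-I singularity = stability of Type-I blow-up under far-field perturbation) is the real, unproved
  mathematics of the whole line, not bookkeeping; `stub_classicalTypeIToMild`: honest bookkeeping — its
  hypotheses admit no junk model (a bounded classical solution extends, `hasSmoothExtensionPast_of_bounded_holds`;
  `HasRapidSpatialDecay` controls all derivatives, so `u 0` IS Schwartz; `IsTypeIBlowup` is only eventual
  but `H¹⁰ ⊂ L^∞` bounds the early slab as in the proved `EulerTypeIGlue`) — BUT its hypothesis
  `IsLerayHopfOn` is LOAD-BEARING: deleted, the stub is equivalent to NSTypeI (KNSS parasitic drift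
  inhabits the rest: `classicalTypeIToMild_withoutLerayHopf_iff_nsTypeI`, section Targets; LANDED as
  `Theorems/EulerProximatePump/Negative/ClassicalTypeIToMildLerayHopf.lean`, p145673), so the proof must spend
  finite energy (weak–strong uniqueness), exactly as `EulerTypeIGlue`'s did; and MAXIMALITY is
  load-bearing the same way (`classicalTypeIToMild_withoutMaximality_iff_nsTypeI`: the rest state
  inhabits classical ∧ LH ∧ decay ∧ `IsTypeIBlowup`, which does not make `T` singular); `stub_doorOfAccumulating` /
  `stub_accumulatingOfDoor` / tools: true by amplitude scaling `u ↦ c u`, `T ↦ c⁻¹T` (all operations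
  linear; `eulerForm_smul₁`, `fourierMultiplier_smul`, `schwartzL2_smul` in tree). Joint sufficiency:
  `EulerProximatePump_of` is sorry-free modulo the stubs — no smuggled gap; the line is exactly as hard
  as stmt-0155 ∧ stmt-14478 (a DSS Millennium counterexample plus its truncation).
* (e) NEAR-MISSES: none sorried. Conditional disproofs available in tree vocabulary, all with NS-hard or
  unproved analytic hypotheses (recorded, not landed as `--negative-modulo`, since the hypotheses are
  conjectures/lemmas rather than unconstructible objects): `LiouvilleConjectureNS ∧ SegmentHotCore ∧
  SegmentZoomLimit → ¬Door` (ideator 2, `SketchIdeator2.not_door_of_liouville`); `(∀ 𝒜 M, ∃ ε > 0,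
  ∀ η ∈ (0,ε), ¬TypeIBlowupFor (B + η•B̃_𝒜) M) → ¬Door` (robust Type-I exclusion near Euler =
  contrapositive of `stub_accumulatingOfDoor`).

WHY IT RESISTS (for the provers): every handle a disprover has — degenerate constants, degenerate data,
dropped clauses, class-wide strengthenings — either collapses onto Navier–Stokes Type-I exclusion
(`euler`, `zero`, `minusEuler` data) or is refuted only CLASS-WIDE (heat points), never for the `∃ 𝒜`
the crux asks. Conversely every PROOF must produce an NS Type-I ancient/blow-up object (zoom sandwich,
ideator 2): the Door is NSTypeI-complete in both directions at bounded temperature.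

## Crux-attack (refuter-rattack-stmt-NavierStokesRegularity-18302-0, 2026-08-17)

Kernel-checked structural facts about the crux `Theses.PumpContinuation.EulerProximatePump` ("the Door"):

* `door_iff` — the Door, refolded: `∃ 𝒜 sym canc, ∃ M, ∀ δ>0, ∃ θ ∈ (1-δ,1) ∩ [0,∞), TypeIBlowupFor (segForm 𝒜 θ) M`.
* `segForm_euler` — at the Euler datum (`mᵢ ≡ 1`), the segment form `(1-θ)B̃_𝒜 + θB` IS the Euler
  form `B` for every `θ` (the segment collapses to a point).
* `door_of_nsTypeI` — **Door ⇐ NSTypeI**: a Schwartz-data `H¹⁰_df`-mild Type-I blow-up of the true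
  Navier–Stokes form with no mild extension gives the Door (witness `𝒜 := euler`, any `θ`).
* `noNSTypeI_of_not_door` — contrapositive: **any refutation `¬ EulerProximatePump` is a proof of
  Type-I blow-up EXCLUSION for Navier–Stokes from Schwartz data** (`∀ M, ¬ TypeIBlowupFor eulerForm M`),
  an open problem (known only under axisymmetry, KNSS 2009 / Seregin–Šverák 2009). Hence the crux is not
  refutable short of that theorem: LOAD-BEARING obstruction to every disproof line.
* `nsTypeI_of_door_of_closed` — **Door ∧ BoundedTemperatureClosed ⇒ NSTypeI** (the first half of the
  route's `closes`, with the Type-I rate kept): so `Door ∧ Closed ↔ NSTypeI` given `Closed`, i.e. the pair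
  of cruxes is exactly as strong as a Type-I Millennium counterexample.

* `typeIBlowupFor_pos` / `door_ceiling_pos` — the COLD SECTOR is empty: a Type-I ceiling `M ≤ 0` forces
  `u ≡ 0`, hence `u₀ ⊥ H¹⁰_df`, hence the zero curve extends — every Door witness has `M > 0`
  (no degenerate loophole in the constant; mirrors `Thesis.Negative.thesisShape_of_nonpos`).
* `rescale`, `rescale_form`, `minusEuler_form`, `segForm_minusEuler` — Tao's class is closed under REAL
  rescaling of one symbol (signs included): `−B` is a symmetric cancelling averaged form, and along ITS
  segment `T_θ = (2θ−1)·B` — the segment passes through the ZERO form (heat equation) at `θ = 1/2` and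
  is a positive multiple of `±B` elsewhere. So (i) "distance to Euler along the segment" is not intrinsic
  — only the projective ratio (Euler : averaged) is, and by amplitude scaling `u ↦ c·u` (form `T ↦ T/c`,
  ceiling `M ↦ cM`) the Door for `𝒜` reads: `B + ε·B̃_𝒜` has bounded-temperature Type-I blow-up for
  arbitrarily small `ε > 0`; (ii) blow-up sets `S_M` along a segment need not be intervals — any
  clopen/connectedness skeleton (`EulerProximatePump_of`) is datum-specific.

No `sorry`. Namespace per the crux-workfile convention.
-/

noncomputable section

-- the summit namespace `…NavierStokesRegularity.NavierStokesRegularity…` is the tree convention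
set_option linter.dupNamespace false

open MeasureTheory Set Filter
open scoped ENNReal
open Literature.Analysis.FluidPDE Literature.Analysis.FluidPDE.Tao2016

namespace Summit.NavierStokesRegularity.NavierStokesRegularity.Cruxes.EulerProximatePump.Disproof

open Summit.NavierStokesRegularity.NavierStokesRegularity.Theses.PumpContinuation

/-- Local notation for `ℝ³`. -/
local notation "ℝ³" => EuclideanSpace ℝ (Fin 3)

/-- The segment form `T_θ = (1-θ) B̃_𝒜 + θ B` of the route, as a named trilinear form. [folklore] -/
def segForm (𝒜 : AveragingDatum) (θ : ℝ) : L2C → L2C → L2C → ℂ :=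
  fun a b c => ((1 - θ : ℝ) : ℂ) * 𝒜.form a b c + ((θ : ℝ) : ℂ) * eulerForm a b c

/-- Bounded-temperature blow-up for a trilinear form `T` with ceiling `M`: a Schwartz divergence-free
datum, a time `S > 0` and an `H¹⁰_df`-mild solution of `∂ₜu = Δu + T(u,u)` on `[0,S)` with the Type-I
rate `‖u t‖_∞ ≤ M (S-t)^{-1/2}` and no mild extension past `S` (the matrix of both cruxes). [folklore] -/
def TypeIBlowupFor (T : L2C → L2C → L2C → ℂ) (M : ℝ) : Prop :=
  ∃ u₀ : SchwartzMap ℝ³ ℝ³, VectorCalculus.IsDivFree ⇑u₀ ∧ ∃ S : ℝ, 0 < S ∧ ∃ u : ℝ → L2C,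
    IsMildSolutionFor T (schwartzL2 u₀) (Ico 0 S) u ∧
    (∀ t ∈ Ico 0 S, eLpNorm (u t) ⊤ volume ≤ ENNReal.ofReal (M / Real.sqrt (S - t))) ∧
    ¬ ∃ S' : ℝ, S < S' ∧ ∃ v : ℝ → L2C,
      IsMildSolutionFor T (schwartzL2 u₀) (Ico 0 S') v ∧ ∀ t ∈ Ico 0 S, v t = u t

/-- **NSTypeI**: the true Navier–Stokes form `B` (Tao (1.5), `ν = 1`) has a Schwartz-data
`H¹⁰_df`-mild Type-I blow-up with no mild extension, for some ceiling `M` (the `θ = 1` endpoint of the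
segment; via the proved support `MildBlowupClassical` + `blowup_assembly` it refutes Clay (A)). [folklore] -/
def NSTypeIMildBlowup : Prop :=
  ∃ M : ℝ, TypeIBlowupFor eulerForm M

/-- The Door, refolded through `segForm` / `TypeIBlowupFor` (definitional). [folklore] -/
theorem door_iff :
    EulerProximatePump ↔
      ∃ 𝒜 : AveragingDatum, 𝒜.IsSymmetric ∧ 𝒜.HasCancellation ∧ ∃ M : ℝ, ∀ δ : ℝ, 0 < δ →
        ∃ θ : ℝ, 1 - δ < θ ∧ θ < 1 ∧ 0 ≤ θ ∧ TypeIBlowupFor (segForm 𝒜 θ) M :=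
  Iff.rfl

/-- **The segment collapses at the Euler datum**: for `𝒜 = euler` (`mᵢ ≡ 1`, `Rᵢ = id`, `λᵢ = 1`,
`euler_form : B̃ = B`) the segment form is `B` for every `θ`. [folklore] -/
theorem segForm_euler (θ : ℝ) : segForm AveragingDatum.euler θ = eulerForm := by
  funext a b c
  simp only [segForm, AveragingDatum.euler_form]
  push_cast
  ring

/-- **Door ⇐ NSTypeI.** A Type-I Millennium counterexample in Tao's mild formulation gives the Door
outright, with the Euler datum as `𝒜` and `θ := max (1 - δ/2) 0`. So the Door is the disjunction
"NSTypeI ∨ genuinely averaged Euler-proximate pumps". [folklore] -/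
theorem door_of_nsTypeI (h : NSTypeIMildBlowup) : EulerProximatePump := by
  obtain ⟨M, hM⟩ := h
  rw [door_iff]
  refine ⟨AveragingDatum.euler, AveragingDatum.euler_isSymmetric,
    AveragingDatum.euler_hasCancellation, M, fun δ hδ => ?_⟩
  refine ⟨max (1 - δ / 2) 0, lt_of_lt_of_le (by linarith) (le_max_left _ _),
    max_lt (by linarith) one_pos, le_max_right _ _, ?_⟩
  rw [segForm_euler]
  exact hM

/-- **Every refutation of the Door proves Type-I exclusion for Navier–Stokes** (Schwartz data,
`H¹⁰_df`-mild, `‖u t‖_∞ ≤ M (S-t)^{-1/2}`, no mild extension) — an open problem (settled only under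
axisymmetry: Koch–Nadirashvili–Seregin–Šverák 2009, Seregin–Šverák 2009). The load-bearing obstruction
to any unconditional `¬ EulerProximatePump`. [folklore] -/
theorem noNSTypeI_of_not_door (h : ¬ EulerProximatePump) : ∀ M : ℝ, ¬ TypeIBlowupFor eulerForm M :=
  fun M hM => h (door_of_nsTypeI ⟨M, hM⟩)

/-- **Door ∧ Closed ⇒ NSTypeI** (first half of the route's deciding theorem `closes`, keeping the
Type-I rate at the endpoint): `1 ∈ closure S_M = S_M` and `T_1 = B`. Together with `door_of_nsTypeI`:
under `BoundedTemperatureClosed`, the Door is EQUIVALENT to a Type-I Millennium counterexample. [folklore] -/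
theorem nsTypeI_of_door_of_closed (hDoor : EulerProximatePump) (hClosed : BoundedTemperatureClosed) :
    NSTypeIMildBlowup := by
  classical
  obtain ⟨𝒜, hsym, hcanc, M, hM⟩ := hDoor
  set Sset : Set ℝ := {θ : ℝ | θ ∈ Set.Icc (0 : ℝ) 1 ∧ TypeIBlowupFor (segForm 𝒜 θ) M} with hSset
  have hcl : IsClosed Sset := hClosed 𝒜 hsym hcanc M
  have h1cl : (1 : ℝ) ∈ closure Sset := by
    rw [Metric.mem_closure_iff]
    intro ε hε
    obtain ⟨θ, hθ1, hθ2, hθ0, hrest⟩ := hM ε hε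
    refine ⟨θ, ⟨⟨hθ0, hθ2.le⟩, hrest⟩, ?_⟩
    rw [Real.dist_eq, abs_of_nonneg (by linarith)]
    linarith
  have h1 : (1 : ℝ) ∈ Sset := by
    rw [hcl.closure_eq] at h1cl
    exact h1cl
  obtain ⟨-, hrest⟩ := h1
  have hform : segForm 𝒜 1 = eulerForm := by
    funext a b c
    simp only [segForm]
    push_cast
    ring
  rw [hform] at hrest
  exact ⟨M, hrest⟩

/-- Under closedness the two are equivalent. [folklore] -/
theorem door_iff_nsTypeI_of_closed (hClosed : BoundedTemperatureClosed) :
    EulerProximatePump ↔ NSTypeIMildBlowup :=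
  ⟨fun h => nsTypeI_of_door_of_closed h hClosed, door_of_nsTypeI⟩


/-! ## The cold sector `M ≤ 0` is empty -/

/-- The segment form kills the zero field in its first slot. [folklore] -/
theorem segForm_zero_left (𝒜 : AveragingDatum) (θ : ℝ) (v w : L2C) : segForm 𝒜 θ 0 v w = 0 := by
  simp [segForm, AveragingDatum.form_zero_left, eulerForm_zero_left]

/-- **No bounded-temperature blow-up at ceiling `M ≤ 0`**, for any form `T` with `T(0,·,·) = 0`: the
Type-I bound forces `u(t) = 0` in `L²` on `[0,S)`, the mild identity at `t = 0` gives `⟨u₀, w⟩ = 0` for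
all `w ∈ H¹⁰_df`, so `⟨e^{tΔ}u₀, w⟩ = ⟨u₀, e^{tΔ}w⟩ = 0` for all `t`, and `v ≡ 0` is a mild solution on
`[0,S+1)` extending `u` — contradiction with non-extension. [folklore] -/
theorem typeIBlowupFor_pos {T : L2C → L2C → L2C → ℂ} (hT : ∀ v w, T 0 v w = 0) {M : ℝ}
    (h : TypeIBlowupFor T M) : 0 < M := by
  by_contra hM
  push Not at hM
  obtain ⟨u₀, -, S, hS, u, hu, hrate, hno⟩ := h
  have hzero : ∀ t ∈ Ico 0 S, u t = 0 := by
    intro t ht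
    have h0 : ENNReal.ofReal (M / Real.sqrt (S - t)) = 0 :=
      ENNReal.ofReal_eq_zero.2 (div_nonpos_of_nonpos_of_nonneg hM (Real.sqrt_nonneg _))
    have h1 : eLpNorm (u t) ⊤ volume = 0 := nonpos_iff_eq_zero.1 (h0 ▸ hrate t ht)
    rw [eLpNorm_eq_zero_iff (Lp.aestronglyMeasurable (u t)) ENNReal.top_ne_zero] at h1
    exact Lp.eq_zero_iff_ae_eq_zero.2 h1
  have horth : ∀ w, MemH10df w → pairing (schwartzL2 u₀) w = 0 := by
    intro w hw
    have h := hu.2.2 0 ⟨le_rfl, hS⟩ w hw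
    rw [hzero 0 ⟨le_rfl, hS⟩, intervalIntegral.integral_same, add_zero, heat_zero,
      pairing_zero_left] at h
    exact h.symm
  refine hno ⟨S + 1, by linarith, fun _ => 0, ⟨fun _ _ => memH10df_zero, continuousInH10On_zero _,
    fun t _ w hw => ?_⟩, fun t ht => (hzero t ht).symm⟩
  simp only [hT, intervalIntegral.integral_zero, add_zero, pairing_zero_left]
  rw [pairing_heat_left]
  exact (horth _ (hw.heat t)).symm

/-- **Every Door witness is hot**: the ceiling `M` of `EulerProximatePump` is positive. [folklore] -/
theorem door_ceiling_pos {𝒜 : AveragingDatum} {M : ℝ}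
    (h : ∀ δ : ℝ, 0 < δ → ∃ θ : ℝ, 1 - δ < θ ∧ θ < 1 ∧ 0 ≤ θ ∧ TypeIBlowupFor (segForm 𝒜 θ) M) :
    0 < M := by
  obtain ⟨θ, -, -, -, hθ⟩ := h 1 one_pos
  exact typeIBlowupFor_pos (segForm_zero_left 𝒜 θ) hθ

/-! ## Real rescaling of a datum; the segment through `−B` -/

/-- **Real rescaling of an averaging datum**: multiply the symbol of slot `0` by the real constant `r`
(Tao 2016, §3.1 p. 15: signs and normalising constants are absorbed into `m_{1,ω}`; accepted
`IsRealSymbol.scaleSymbol`). The form scales by `r` (`rescale_form`); `r < 0` is allowed. [cite: Tao2016AveragedNS, §3.1 p. 15] -/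
def rescale (𝒜 : AveragingDatum) (r : ℝ) : AveragingDatum where
  Ω := 𝒜.Ω
  μ := 𝒜.μ
  m i θ := if i = 0 then scaleSymbol r (𝒜.m 0 θ) else 𝒜.m i θ
  R := 𝒜.R
  lam := 𝒜.lam
  isRealSymbol i θ := by
    by_cases hi : i = 0
    · subst hi
      simpa using (𝒜.isRealSymbol 0 θ).scaleSymbol r
    · simpa [hi] using 𝒜.isRealSymbol i θ
  det_R := 𝒜.det_R
  lam_pos := 𝒜.lam_pos
  lam_bdd := 𝒜.lam_bdd
  moment k₁ k₂ k₃ := by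
    simp only [if_true, show (1 : Fin 3) ≠ 0 by decide, show (2 : Fin 3) ≠ 0 by decide, if_false]
    calc ∫⁻ θ, symbolSeminorm k₁ (scaleSymbol r (𝒜.m 0 θ)) * symbolSeminorm k₂ (𝒜.m 1 θ) *
          symbolSeminorm k₃ (𝒜.m 2 θ) ∂𝒜.μ
        ≤ ∫⁻ θ, ‖(r : ℂ)‖ₑ * (symbolSeminorm k₁ (𝒜.m 0 θ) * symbolSeminorm k₂ (𝒜.m 1 θ) *
          symbolSeminorm k₃ (𝒜.m 2 θ)) ∂𝒜.μ := by
          refine lintegral_mono fun θ => ?_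
          rw [← mul_assoc, ← mul_assoc]
          gcongr
          exact symbolSeminorm_scaleSymbol_le r (𝒜.isRealSymbol 0 θ).1 k₁
      _ < ∞ := by
          rw [lintegral_const_mul' _ _ enorm_ne_top]
          exact ENNReal.mul_lt_top enorm_lt_top (𝒜.moment k₁ k₂ k₃)
  measurable_m i ξ hξ := by
    by_cases hi : i = 0
    · subst hi
      simpa [scaleSymbol] using (𝒜.measurable_m 0 ξ hξ).const_mul (r : ℂ)
    · simpa [hi] using 𝒜.measurable_m i ξ hξ
  measurable_R := 𝒜.measurable_R
  measurable_lam := 𝒜.measurable_lam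

/-- Slot `0` of the rescaled datum is `r` times slot `0`. [folklore] -/
theorem rescale_slot_zero (𝒜 : AveragingDatum) (r : ℝ) (θ : 𝒜.Ω) (u : L2C) :
    (rescale 𝒜 r).slot 0 θ u = (r : ℂ) • 𝒜.slot 0 θ u := by
  have h : (rescale 𝒜 r).symbolLp 0 θ = (r : ℂ) • 𝒜.symbolLp 0 θ := by
    unfold AveragingDatum.symbolLp
    rw [← toLp_scaleSymbol (𝒜.isRealSymbol 0 θ).memLp_top r
      (((𝒜.isRealSymbol 0 θ).scaleSymbol r).memLp_top)]
    exact MemLp.toLp_congr _ _ (Eventually.of_forall fun ξ => rfl)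
  change fourierMultiplier ((rescale 𝒜 r).symbolLp 0 θ) (rot (𝒜.R 0 θ) (dil (𝒜.lam 0 θ) u)) =
    (r : ℂ) • fourierMultiplier (𝒜.symbolLp 0 θ) (rot (𝒜.R 0 θ) (dil (𝒜.lam 0 θ) u))
  rw [h, fourierMultiplier_symbol_smul]

/-- Slots `1, 2` of the rescaled datum are unchanged. [folklore] -/
theorem rescale_slot_of_ne_zero (𝒜 : AveragingDatum) (r : ℝ) {i : Fin 3} (hi : i ≠ 0) (θ : 𝒜.Ω)
    (u : L2C) : (rescale 𝒜 r).slot i θ u = 𝒜.slot i θ u := by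
  have hm : (rescale 𝒜 r).m i θ = 𝒜.m i θ := by simp [rescale, hi]
  have h : (rescale 𝒜 r).symbolLp i θ = 𝒜.symbolLp i θ := by
    unfold AveragingDatum.symbolLp
    exact MemLp.toLp_congr _ _ (Eventually.of_forall fun ξ => by rw [hm])
  change fourierMultiplier ((rescale 𝒜 r).symbolLp i θ) (rot (𝒜.R i θ) (dil (𝒜.lam i θ) u)) =
    fourierMultiplier (𝒜.symbolLp i θ) (rot (𝒜.R i θ) (dil (𝒜.lam i θ) u))
  rw [h]

/-- **The rescaled datum averages `B` to `r` times the average**: `B̃_{rescale 𝒜 r} = r · B̃_𝒜`. [cite: Tao2016AveragedNS, §3.1 p. 15] -/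
theorem rescale_form (𝒜 : AveragingDatum) (r : ℝ) (u v w : L2C) :
    (rescale 𝒜 r).form u v w = (r : ℂ) * 𝒜.form u v w := by
  change ∫ θ, eulerForm ((rescale 𝒜 r).slot 0 θ u) ((rescale 𝒜 r).slot 1 θ v)
      ((rescale 𝒜 r).slot 2 θ w) ∂𝒜.μ = (r : ℂ) * ∫ θ, eulerForm (𝒜.slot 0 θ u) (𝒜.slot 1 θ v)
      (𝒜.slot 2 θ w) ∂𝒜.μ
  rw [← integral_const_mul]
  refine integral_congr_ae (Eventually.of_forall fun θ => ?_)
  change eulerForm ((rescale 𝒜 r).slot 0 θ u) ((rescale 𝒜 r).slot 1 θ v)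
      ((rescale 𝒜 r).slot 2 θ w) =
    (r : ℂ) * eulerForm (𝒜.slot 0 θ u) (𝒜.slot 1 θ v) (𝒜.slot 2 θ w)
  rw [rescale_slot_zero, rescale_slot_of_ne_zero 𝒜 r (show (1 : Fin 3) ≠ 0 by decide),
    rescale_slot_of_ne_zero 𝒜 r (show (2 : Fin 3) ≠ 0 by decide), eulerForm_smul₁]

/-- Rescaling preserves symmetry. [folklore] -/
theorem rescale_isSymmetric {𝒜 : AveragingDatum} (h : 𝒜.IsSymmetric) (r : ℝ) :
    (rescale 𝒜 r).IsSymmetric := fun u v w hu hv hw => by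
  rw [rescale_form, rescale_form, h u v w hu hv hw]

/-- Rescaling preserves the cancellation property. [folklore] -/
theorem rescale_hasCancellation {𝒜 : AveragingDatum} (h : 𝒜.HasCancellation) (r : ℝ) :
    (rescale 𝒜 r).HasCancellation := fun u hu => by
  rw [rescale_form, h u hu, mul_zero]

/-- **`−B` is a symmetric cancelling averaged Euler form**: the datum `mᵢ ≡ (−1, 1, 1)`. [folklore] -/
def minusEuler : AveragingDatum := rescale AveragingDatum.euler (-1)

/-- `B̃_{minusEuler} = −B`. [folklore] -/
theorem minusEuler_form (u v w : L2C) : minusEuler.form u v w = -eulerForm u v w := by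
  rw [minusEuler, rescale_form, AveragingDatum.euler_form]
  push_cast
  ring

/-- `minusEuler` is symmetric and cancelling (so it is an admissible `𝒜` for both cruxes). [folklore] -/
theorem minusEuler_isSymmetric_hasCancellation :
    minusEuler.IsSymmetric ∧ minusEuler.HasCancellation :=
  ⟨rescale_isSymmetric AveragingDatum.euler_isSymmetric _,
    rescale_hasCancellation AveragingDatum.euler_hasCancellation _⟩

/-- **The segment through `−B` is `T_θ = (2θ − 1)·B`**: a positive multiple of `B` for `θ > 1/2`
(equivalent to Navier–Stokes by amplitude scaling, ceiling `(2θ−1)M`), a positive multiple of `−B` for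
`θ < 1/2` (again Navier–Stokes, `u ↦ −(1−2θ)u`), and the ZERO form (heat equation, no blow-up) at
`θ = 1/2`: blow-up sets along a segment need not be intervals. [folklore] -/
theorem segForm_minusEuler (θ : ℝ) :
    segForm minusEuler θ = fun a b c => ((2 * θ - 1 : ℝ) : ℂ) * eulerForm a b c := by
  funext a b c
  simp only [segForm, minusEuler_form]
  push_cast
  ring

/-- At `θ = 1/2` the segment through `−B` is the heat equation (zero forcing form). [folklore] -/
theorem segForm_minusEuler_half : segForm minusEuler (1 / 2) = fun _ _ _ => 0 := by
  funext a b c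
  simp only [segForm, minusEuler_form]
  push_cast
  ring

/-! ## Cycle 1 (cdisprove, 2026-08-17): load-bearing conjuncts, heat points, the zero datum

Landed copies (importable by ideators / planners / provers): `Theorems/EulerProximatePump/Negative/`
`DoorObstructions.lean` (p145292), `HeatOnSegment.lean` (p145657), `ClassicalTypeIToMildLerayHopf.lean`
(p145673) — notation `tIB[T, M]` = `TypeIBlowupFor T M`, `seg[𝒜, θ]` = `segForm 𝒜 θ` there. This work
file keeps its own copies so that it elaborates independently of farm snapshot freshness. -/

section CycleOne

open Literature.Analysis.FunctionSpaces (eFourierSobolevNorm)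
open Summit.NavierStokesRegularity.NavierStokesRegularity.Theorems.PerpetualPumpEulerTypeIGlue
  (fourierFn_heat_sub_heat)
open Summit.NavierStokesRegularity.NavierStokesRegularity.Theorems.BoundedTemperatureClosed.Negative
  (isMildSolutionFor_congr_diag)
open scoped SchwartzMap Topology

/-! ### (a) Load-bearing analysis of the conjuncts -/

/-- **Ceilings may be enlarged**: `TypeIBlowupFor T M → TypeIBlowupFor T M'` for `M ≤ M'`. [folklore] -/
theorem typeIBlowupFor_mono {T : L2C → L2C → L2C → ℂ} {M M' : ℝ} (hMM' : M ≤ M')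
    (h : TypeIBlowupFor T M) : TypeIBlowupFor T M' := by
  obtain ⟨u₀, hdiv, S, hS, u, hu, hrate, hno⟩ := h
  refine ⟨u₀, hdiv, S, hS, u, hu, fun t ht => (hrate t ht).trans ?_, hno⟩
  exact ENNReal.ofReal_le_ofReal (div_le_div_of_nonneg_right hMM' (Real.sqrt_nonneg _))

/-- The segment forms of `𝒜.symmetrize` and `𝒜` agree on the diagonal. [folklore] -/
theorem segForm_symmetrize_diag' (𝒜 : AveragingDatum) (θ : ℝ) (a c : L2C) :
    segForm 𝒜.symmetrize θ a a c = segForm 𝒜 θ a a c := by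
  simp only [segForm,
    Summit.NavierStokesRegularity.NavierStokesRegularity.Theorems.AveragedTypeIBlowup.Negative.symmetrize_form_diag]

/-- Symmetrising the datum does not change the blow-ups along the segment. [folklore] -/
theorem typeIBlowupFor_segForm_symmetrize_iff (𝒜 : AveragingDatum) (θ M : ℝ) :
    TypeIBlowupFor (segForm 𝒜.symmetrize θ) M ↔ TypeIBlowupFor (segForm 𝒜 θ) M := by
  unfold TypeIBlowupFor
  simp only [isMildSolutionFor_congr_diag (segForm_symmetrize_diag' 𝒜 θ)]

/-- **`IsSymmetric` is decoration in the Door** (hypothesis mutation, proved): the crux is equivalent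
to its version over ALL cancelling data (symmetrise: `symmetrize_isSymmetric`,
`symmetrize_hasCancellation_iff`, Tao 2016 Remark 1.6). [folklore] -/
theorem door_iff_noSymm :
    EulerProximatePump ↔
      ∃ 𝒜 : AveragingDatum, 𝒜.HasCancellation ∧ ∃ M : ℝ, ∀ δ : ℝ, 0 < δ →
        ∃ θ : ℝ, 1 - δ < θ ∧ θ < 1 ∧ 0 ≤ θ ∧ TypeIBlowupFor (segForm 𝒜 θ) M := by
  rw [door_iff]
  constructor
  · rintro ⟨𝒜, -, hc, M, hM⟩
    exact ⟨𝒜, hc, M, hM⟩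
  · rintro ⟨𝒜, hc, M, hM⟩
    refine ⟨𝒜.symmetrize, 𝒜.symmetrize_isSymmetric, 𝒜.symmetrize_hasCancellation_iff.2 hc, M,
      fun δ hδ => ?_⟩
    obtain ⟨θ, h1, h2, h3, hθ⟩ := hM δ hδ
    exact ⟨θ, h1, h2, h3, (typeIBlowupFor_segForm_symmetrize_iff 𝒜 θ M).2 hθ⟩

/-- **The clause `0 ≤ θ` is decoration** (shrink `δ` to `min δ 1`). [folklore] -/
theorem door_iff_noNonneg :
    EulerProximatePump ↔
      ∃ 𝒜 : AveragingDatum, 𝒜.IsSymmetric ∧ 𝒜.HasCancellation ∧ ∃ M : ℝ, ∀ δ : ℝ, 0 < δ →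
        ∃ θ : ℝ, 1 - δ < θ ∧ θ < 1 ∧ TypeIBlowupFor (segForm 𝒜 θ) M := by
  rw [door_iff]
  constructor
  · rintro ⟨𝒜, hs, hc, M, hM⟩
    refine ⟨𝒜, hs, hc, M, fun δ hδ => ?_⟩
    obtain ⟨θ, h1, h2, -, hθ⟩ := hM δ hδ
    exact ⟨θ, h1, h2, hθ⟩
  · rintro ⟨𝒜, hs, hc, M, hM⟩
    refine ⟨𝒜, hs, hc, M, fun δ hδ => ?_⟩
    obtain ⟨θ, h1, h2, hθ⟩ := hM (min δ 1) (lt_min hδ one_pos)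
    exact ⟨θ, lt_of_le_of_lt (by linarith [min_le_left δ 1]) h1, h2,
      by linarith [min_le_right δ 1], hθ⟩

/-- The `L²` class of the zero Schwartz field is `0`. [folklore] -/
theorem schwartzL2_zero : schwartzL2 (0 : 𝓢(ℝ³, ℝ³)) = 0 := by
  simpa using schwartzL2_smul 0 (0 : 𝓢(ℝ³, ℝ³))

/-- The zero Schwartz field is divergence free. [folklore] -/
theorem isDivFree_schwartz_zero : VectorCalculus.IsDivFree ⇑(0 : 𝓢(ℝ³, ℝ³)) := by
  intro x
  simp [VectorCalculus.divergence, FunLike.coe_zero]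

/-- **Dropping the non-extension clause makes the crux trivial** (vacuity probe, proved): the zero
flow (datum `0`, `u ≡ 0` on `[0,1)`, ceiling `M = 0`, Euler datum, any admissible `θ`) inhabits
everything but the blow-up. The non-extension clause is THE load-bearing conjunct. [folklore] -/
theorem doorWithoutNonExtension_trivial :
    ∃ 𝒜 : AveragingDatum, 𝒜.IsSymmetric ∧ 𝒜.HasCancellation ∧ ∃ M : ℝ, ∀ δ : ℝ, 0 < δ →
      ∃ θ : ℝ, 1 - δ < θ ∧ θ < 1 ∧ 0 ≤ θ ∧ ∃ u₀ : 𝓢(ℝ³, ℝ³), VectorCalculus.IsDivFree ⇑u₀ ∧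
        ∃ S : ℝ, 0 < S ∧ ∃ u : ℝ → L2C, IsMildSolutionFor (segForm 𝒜 θ) (schwartzL2 u₀) (Ico 0 S) u ∧
          ∀ t ∈ Ico 0 S, eLpNorm (u t) ⊤ volume ≤ ENNReal.ofReal (M / Real.sqrt (S - t)) := by
  refine ⟨AveragingDatum.euler, AveragingDatum.euler_isSymmetric,
    AveragingDatum.euler_hasCancellation, 0, fun δ hδ => ?_⟩
  refine ⟨max (1 - δ / 2) 0, lt_of_lt_of_le (by linarith) (le_max_left _ _),
    max_lt (by linarith) one_pos, le_max_right _ _, 0, isDivFree_schwartz_zero, 1, one_pos,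
    fun _ => 0, ?_, fun t _ => ?_⟩
  · rw [schwartzL2_zero]
    exact isMildSolutionFor_zero (fun w => segForm_zero_left AveragingDatum.euler _ 0 w) _
  · have h0 : eLpNorm ((0 : L2C) : ℝ³ → EuclideanSpace ℂ (Fin 3)) ⊤ volume = 0 := by
      rw [eLpNorm_congr_ae (Lp.coeFn_zero _ _ _), eLpNorm_zero]
    rw [h0]
    exact zero_le

/-! ### (c) Heat points: the zero form never blows up; the zero datum; the hole at `θ = 1/2` through `−B` -/

/-- The Fourier-side `H¹⁰` integral of an `H¹⁰` field is finite. [folklore] -/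
theorem lintegral_weight_fourierFn_lt_top {a : L2C} (ha : eFourierSobolevNorm 10 a < ∞) :
    ∫⁻ ξ : ℝ³, ENNReal.ofReal ((1 + ‖ξ‖ ^ 2) ^ (10 : ℝ)) * ‖fourierFn a ξ‖ₑ ^ 2 < ∞ := by
  by_contra h
  rw [not_lt, top_le_iff] at h
  unfold eFourierSobolevNorm at ha
  change (∫⁻ ξ : ℝ³, ENNReal.ofReal ((1 + ‖ξ‖ ^ 2) ^ (10 : ℝ)) * ‖fourierFn a ξ‖ₑ ^ 2) ^ (1 / 2 : ℝ) < ∞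
    at ha
  rw [h, ENNReal.top_rpow_of_pos (by norm_num)] at ha
  exact lt_irrefl _ ha

/-- **Strong continuity of the heat flow in `H¹⁰`** (dominated convergence on the Fourier side). [folklore] -/
theorem continuousInH10On_heat {a : L2C} (ha : eFourierSobolevNorm 10 a < ∞) (I : Set ℝ) :
    ContinuousInH10On I (fun t => heat t a) := by
  intro t₀ _
  refine Tendsto.mono_left ?_ nhdsWithin_le_nhds
  set W : ℝ³ → ℝ≥0∞ := fun ξ => ENNReal.ofReal ((1 + ‖ξ‖ ^ 2) ^ (10 : ℝ)) with hW
  have hsq : ∀ t, eFourierSobolevNorm 10 (heat t a - heat t₀ a) =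
      (∫⁻ ξ, W ξ * (‖heatSymbol t ξ - heatSymbol t₀ ξ‖ₑ ^ 2 * ‖fourierFn a ξ‖ₑ ^ 2)) ^ (1 / 2 : ℝ) := by
    intro t
    unfold eFourierSobolevNorm
    congr 1
    refine lintegral_congr_ae ?_
    filter_upwards [fourierFn_heat_sub_heat t t₀ a] with ξ hξ
    change W ξ * ‖fourierFn (heat t a - heat t₀ a) ξ‖ₑ ^ 2 = _
    rw [hξ, enorm_smul, mul_pow]
  have hlim : Tendsto (fun t => ∫⁻ ξ, W ξ * (‖heatSymbol t ξ - heatSymbol t₀ ξ‖ₑ ^ 2 * ‖fourierFn a ξ‖ₑ ^ 2))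
      (𝓝 t₀) (𝓝 0) := by
    have hWm : Measurable W := by
      rw [hW]
      exact ENNReal.measurable_ofReal.comp (by fun_prop)
    have hmeas : ∀ t, AEMeasurable
        (fun ξ => W ξ * (‖heatSymbol t ξ - heatSymbol t₀ ξ‖ₑ ^ 2 * ‖fourierFn a ξ‖ₑ ^ 2)) volume :=
      fun t => hWm.aemeasurable.mul
        (((((continuous_heatSymbol t).sub (continuous_heatSymbol t₀)).aestronglyMeasurable.enorm.pow_const
          2)).mul ((aestronglyMeasurable_fourierFn a).enorm.pow_const 2))
    have hfin : ∫⁻ ξ, W ξ * (4 * ‖fourierFn a ξ‖ₑ ^ 2) ≠ ⊤ := by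
      have h4 : ∫⁻ ξ, W ξ * (4 * ‖fourierFn a ξ‖ₑ ^ 2) = 4 * ∫⁻ ξ, W ξ * ‖fourierFn a ξ‖ₑ ^ 2 := by
        rw [← lintegral_const_mul' _ _ (by norm_num)]
        refine lintegral_congr fun ξ => ?_
        ring
      rw [h4]
      exact ENNReal.mul_ne_top (by norm_num) (lintegral_weight_fourierFn_lt_top ha).ne
    have h0 : (0 : ℝ≥0∞) = ∫⁻ _ξ : ℝ³, 0 := lintegral_zero.symm
    rw [h0]
    refine tendsto_lintegral_filter_of_dominated_convergence' (fun ξ => W ξ * (4 * ‖fourierFn a ξ‖ₑ ^ 2))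
      (Eventually.of_forall hmeas) (Eventually.of_forall fun t => Eventually.of_forall fun ξ => ?_) hfin
      (Eventually.of_forall fun ξ => ?_)
    · refine mul_le_mul' le_rfl (mul_le_mul' ?_ le_rfl)
      have h1 : ‖heatSymbol t ξ - heatSymbol t₀ ξ‖ₑ ≤ 2 := by
        refine (enorm_sub_le).trans ?_
        calc ‖heatSymbol t ξ‖ₑ + ‖heatSymbol t₀ ξ‖ₑ ≤ 1 + 1 :=
              add_le_add (enorm_heatSymbol_le t ξ) (enorm_heatSymbol_le t₀ ξ)
          _ = 2 := by norm_num
      calc ‖heatSymbol t ξ - heatSymbol t₀ ξ‖ₑ ^ 2 ≤ 2 ^ 2 := by gcongr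
        _ = 4 := by norm_num
    · have hc : Continuous fun t : ℝ => heatSymbol t ξ :=
        continuous_heatSymbol₂.comp (continuous_id.prodMk continuous_const)
      have ht : Tendsto (fun t => W ξ * (‖heatSymbol t ξ - heatSymbol t₀ ξ‖ₑ ^ 2 * ‖fourierFn a ξ‖ₑ ^ 2))
          (𝓝 t₀) (𝓝 (W ξ * (‖heatSymbol t₀ ξ - heatSymbol t₀ ξ‖ₑ ^ 2 * ‖fourierFn a ξ‖ₑ ^ 2))) := by
        refine ENNReal.Tendsto.const_mul ?_ (Or.inr ENNReal.ofReal_ne_top)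
        refine ENNReal.Tendsto.mul_const (ENNReal.Tendsto.pow ?_) (Or.inr (ENNReal.pow_ne_top enorm_ne_top))
        exact (continuous_enorm.comp (hc.sub continuous_const)).continuousAt.tendsto
      simpa using ht
  have h2 : Tendsto (fun t => (∫⁻ ξ, W ξ * (‖heatSymbol t ξ - heatSymbol t₀ ξ‖ₑ ^ 2 * ‖fourierFn a ξ‖ₑ ^ 2)) ^
      (1 / 2 : ℝ)) (𝓝 t₀) (𝓝 (0 ^ (1 / 2 : ℝ))) :=
    (ENNReal.continuous_rpow_const.tendsto 0).comp hlim
  rw [ENNReal.zero_rpow_of_pos (by norm_num)] at h2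
  refine h2.congr fun t => ?_
  rw [hsq]

/-- **The free heat flow of an `H¹⁰_df` field is a global mild solution of the zero form.** [folklore] -/
theorem isMildSolutionFor_zeroForm_heat {a : L2C} (ha : MemH10df a) (I : Set ℝ) :
    IsMildSolutionFor (fun _ _ _ => 0) a I (fun t => heat t a) :=
  ⟨fun t _ => ha.heat t, continuousInH10On_heat ha.1 I, fun t _ w _ => by simp⟩

/-- **Uniqueness for the zero form**: a mild solution of `∂ₜu = Δu` on `I ∋ 0` is the heat flow of its
initial slice. [folklore] -/
theorem eq_heat_of_isMildSolutionFor_zeroForm {u₀ : L2C} {I : Set ℝ} {u : ℝ → L2C}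
    (hu : IsMildSolutionFor (fun _ _ _ => 0) u₀ I u) (h0 : (0 : ℝ) ∈ I) {t : ℝ} (ht : t ∈ I) :
    u t = heat t (u 0) := by
  have ha : MemH10df (u 0) := hu.1 0 h0
  have hpair : ∀ w, MemH10df w → pairing (u t) w = pairing (heat t (u 0)) w := by
    intro w hw
    have h := hu.2.2 t ht w hw
    simp only [intervalIntegral.integral_zero, add_zero] at h
    rw [h, pairing_heat_left, pairing_heat_left]
    exact (hu.initial h0 (hw.heat t)).symm
  have hd : MemH10df (u t - heat t (u 0)) := (hu.1 t ht).sub (ha.heat t)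
  have hself : pairing (u t - heat t (u 0)) (u t - heat t (u 0)) = 0 := by
    rw [pairing_sub_left, hpair _ hd, sub_self]
  exact sub_eq_zero.1 (eq_zero_of_pairing_self_eq_zero hd.2.1 hself)

/-- **The zero form (heat equation) has no bounded-temperature blow-up**, at any ceiling. [folklore] -/
theorem not_typeIBlowupFor_zeroForm (M : ℝ) : ¬ TypeIBlowupFor (fun _ _ _ => 0) M := by
  rintro ⟨u₀, -, S, hS, u, hu, -, hno⟩
  have h0 : (0 : ℝ) ∈ Ico 0 S := ⟨le_rfl, hS⟩
  have ha : MemH10df (u 0) := hu.1 0 h0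
  refine hno ⟨S + 1, by linarith, fun t => heat t (u 0), ⟨fun t _ => ha.heat t,
    continuousInH10On_heat ha.1 _, fun t _ w hw => ?_⟩, fun t ht => ?_⟩
  · simp only [intervalIntegral.integral_zero, add_zero]
    rw [pairing_heat_left, pairing_heat_left]
    exact hu.initial h0 (hw.heat t)
  · exact (eq_heat_of_isMildSolutionFor_zeroForm hu h0 ht).symm

/-- **The hole at `θ = 1/2` on the segment through `−B`**: no bounded-temperature blow-up there, at any
ceiling — blow-up sets along admissible segments need not be intervals. [folklore] -/
theorem not_typeIBlowupFor_segForm_minusEuler_half (M : ℝ) :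
    ¬ TypeIBlowupFor (segForm minusEuler (1 / 2)) M := by
  rw [segForm_minusEuler_half]
  exact not_typeIBlowupFor_zeroForm M

/-- The zero datum (`mᵢ ≡ 0`) is symmetric. [folklore] -/
theorem zero_isSymmetric : AveragingDatum.zero.IsSymmetric := fun u v w _ _ _ => by
  rw [AveragingDatum.zero_form, AveragingDatum.zero_form]

/-- The zero datum has the cancellation property. [folklore] -/
theorem zero_hasCancellation : AveragingDatum.zero.HasCancellation := fun u _ =>
  AveragingDatum.zero_form u u u

/-- **The segment of the zero datum is `T_θ = θ·B`**: the heat equation at `θ = 0`, positive multiples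
of the Navier–Stokes form for `θ > 0` (a second collapse of the Door onto NSTypeI). [folklore] -/
theorem segForm_zeroDatum (θ : ℝ) :
    segForm AveragingDatum.zero θ = fun a b c => ((θ : ℝ) : ℂ) * eulerForm a b c := by
  funext a b c
  simp [segForm, AveragingDatum.zero_form]

/-- At `θ = 0` the zero datum's segment is the zero form. [folklore] -/
theorem segForm_zeroDatum_zero : segForm AveragingDatum.zero 0 = fun _ _ _ => (0 : ℂ) := by
  funext a b c
  simp [segForm, AveragingDatum.zero_form]

/-- Tao's end of the zero datum's segment is cold. [folklore] -/
theorem not_typeIBlowupFor_segForm_zeroDatum_zero (M : ℝ) :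
    ¬ TypeIBlowupFor (segForm AveragingDatum.zero 0) M := by
  rw [segForm_zeroDatum_zero]
  exact not_typeIBlowupFor_zeroForm M

/-- **Refuted class-wide strengthening of the seed**: NOT every symmetric cancelling datum pumps at
Tao's end `θ = 0` of its segment; the route's `0 ∈ S_M` (SeedOpen) is datum-specific. [folklore] -/
theorem not_forall_admissible_seedIgnited :
    ¬ ∀ 𝒜 : AveragingDatum, 𝒜.IsSymmetric → 𝒜.HasCancellation →
      ∃ M : ℝ, TypeIBlowupFor (segForm 𝒜 0) M := by
  intro h
  obtain ⟨M, hM⟩ := h AveragingDatum.zero zero_isSymmetric zero_hasCancellation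
  exact not_typeIBlowupFor_segForm_zeroDatum_zero M hM

/-! ### (d) Targets — the lead's line `Lines/SketchIdeator2.lean`

No stub is breakable (see the index). One checked LOAD-BEARING fact about `stub_classicalTypeIToMild`
(proposed as `Theorems/EulerProximatePump/Negative/ClassicalTypeIToMildLerayHopf.lean`): its hypothesis
`IsLerayHopfOn` cannot be dropped — without it the stub is NSTypeI itself (KNSS parasitic drift). -/

section Targets

open Summit.NavierStokesRegularity.NavierStokesRegularity.Theorems.RungReynoldsOneNegative
  (drift driftP drift_isClassical drift_rapidDecay drift_not_hasSmoothExtensionPast gI gI_zero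
    gI_contDiffOn tendsto_abs_gI_atTop)
open Summit.NavierStokesRegularity.NavierStokesRegularity.Theorems.EulerTypeIGlue.Negative
  (isTypeIBlowup_driftI)

/-- **The KNSS drift `u = ((1-t)^{-1/2} - 1)e₀`, `p = -½(1-t)^{-3/2}x₀` inhabits the Leray–Hopf-free
hypotheses of `stub_classicalTypeIToMild`** at `ν = T = 1`. [cite: KochNadirashviliSereginSverak2009, §1 p. 3] -/
theorem driftI_inhabits_hypotheses_withoutLerayHopf :
    IsMaximalSmoothSolution 1 0 (drift (gI 1)) (driftP (gI 1)) 1 ∧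
      HasRapidSpatialDecay (drift (gI 1) 0) ∧ IsTypeIBlowup (drift (gI 1)) 1 :=
  ⟨⟨drift_isClassical (gI_contDiffOn 1) 1, drift_not_hasSmoothExtensionPast (tendsto_abs_gI_atTop 1 one_pos) 1⟩,
    drift_rapidDecay (gI_zero 1), isTypeIBlowup_driftI zero_le_one⟩

/-- **`IsLerayHopfOn` is load-bearing in `stub_classicalTypeIToMild`**: with it deleted the stub is
EQUIVALENT to NSTypeI (its own conclusion). [folklore] -/
theorem classicalTypeIToMild_withoutLerayHopf_iff_nsTypeI :
    (∀ ν : ℝ, 0 < ν → ∀ T : ℝ, 0 < T → ∀ (u : ℝ → ℝ³ → ℝ³) (p : ℝ → ℝ³ → ℝ),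
      IsMaximalSmoothSolution ν 0 u p T → HasRapidSpatialDecay (u 0) → IsTypeIBlowup u T →
      NSTypeIMildBlowup) ↔ NSTypeIMildBlowup := by
  refine ⟨fun h => ?_, fun h _ _ _ _ _ _ _ _ _ => h⟩
  obtain ⟨hmax, hdec, hI⟩ := driftI_inhabits_hypotheses_withoutLerayHopf
  exact h 1 one_pos 1 one_pos _ _ hmax hdec hI

/-- **A disproof of the Door refutes the Leray–Hopf-free stub.** [folklore] -/
theorem not_classicalTypeIToMild_withoutLerayHopf_of_not_door (h : ¬ EulerProximatePump) :
    ¬ ∀ ν : ℝ, 0 < ν → ∀ T : ℝ, 0 < T → ∀ (u : ℝ → ℝ³ → ℝ³) (p : ℝ → ℝ³ → ℝ),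
      IsMaximalSmoothSolution ν 0 u p T → HasRapidSpatialDecay (u 0) → IsTypeIBlowup u T →
      NSTypeIMildBlowup := by
  rw [classicalTypeIToMild_withoutLerayHopf_iff_nsTypeI]
  rintro ⟨M, hM⟩
  exact noNSTypeI_of_not_door h M hM

/-- The zero field decays rapidly with all derivatives. [folklore] -/
theorem hasRapidSpatialDecay_zero : HasRapidSpatialDecay (0 : ℝ³ → ℝ³) := by
  intro n K
  refine ⟨0, fun x => ?_⟩
  simp

/-- The rest state obeys every Type-I bound (`IsTypeIBlowup` does not make `T` singular). [folklore] -/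
theorem isTypeIBlowup_zero (T : ℝ) : IsTypeIBlowup (0 : ℝ → ℝ³ → ℝ³) T :=
  ⟨0, Eventually.of_forall fun t x => by simp⟩

/-- **Maximality is load-bearing in `stub_classicalTypeIToMild`**: with `IsMaximalSmoothSolution`
weakened to `IsClassicalNSSolutionOn (Ico 0 T)` the stub is equivalent to NSTypeI (rest state). [folklore] -/
theorem classicalTypeIToMild_withoutMaximality_iff_nsTypeI :
    (∀ ν : ℝ, 0 < ν → ∀ T : ℝ, 0 < T → ∀ (u : ℝ → ℝ³ → ℝ³) (p : ℝ → ℝ³ → ℝ),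
      IsClassicalNSSolutionOn (Ico 0 T) ν 0 u p → IsLerayHopfOn T ν 0 (u 0) u →
      HasRapidSpatialDecay (u 0) → IsTypeIBlowup u T → NSTypeIMildBlowup) ↔ NSTypeIMildBlowup := by
  refine ⟨fun h => ?_, fun h _ _ _ _ _ _ _ _ _ _ => h⟩
  exact h 1 one_pos 1 one_pos 0 0 (isClassicalNSSolutionOn_zero _ _) (isLerayHopfOn_zero 1 1)
    hasRapidSpatialDecay_zero (isTypeIBlowup_zero 1)

end Targets

end CycleOne

end Summit.NavierStokesRegularity.NavierStokesRegularity.Cruxes.EulerProximatePump.Disproof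

end
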